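import Summits.ABC.ABC.Theses.DefiniteXi
import Literature.NumberTheory.Automorphic.BCDTModularity
import HarnessLib

/-!
# `stub_modThree` — ideator k = 3, GENERATION 15: typed sanity of the gen-15 helper statements (T-C)

Elaboration sketch only (nothing registered).  T-C ("extremal call-set"): over ALL `E/ℚ` the
surjective half F‴ of the stub is *exactly* "every surjective `ρ̄ : Γ_ℚ → GL₂(𝔽₃)` with
`det ρ̄ = χ̄₃` is modular" — because every such `ρ̄` IS `E[3]` for (infinitely many) `E/ℚ`
(Rubin, *Modularity of mod 5 representations*, in Cornell–Silverman–Stevens 1997, Thm. 3 with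
`p = 3`, proof p. 561–562: `X(ρ̄)` is the twist of `X(3) ≅ ℙ¹` by a class killed by `2` and by
`m = #PSL₂(𝔽₃)/12 = 1`, hence trivial).  So the `∀ W`-quantifier gives NO weakening of
Langlands–Tunnell's octahedral case; only the use-site (Frey curves) could, and gens 12–14 showed
it does not (LT is blind to `E[2]`).
-/

set_option linter.dupNamespace false

noncomputable section

open Literature.NumberTheory.EllipticCurves
open Literature.NumberTheory.GaloisRepresentations
open WeierstrassCurve Matrix

namespace Summit.ABC.ABC.Cruxes.FreyModularity.StubIdeasModThree3G15

/-- F‴ (the frozen, surjective = octahedral half of `stub_modThree`; k2/k3 common form). -/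
abbrev SigStubModThreeSurj : Prop :=
  ∀ (W : WeierstrassCurve ℚ) [W.IsElliptic] (ρ : ModPGaloisRep ℚ (ZMod 3) 2),
    W.IsTorsionGaloisRep 3 ρ → Function.Surjective ρ → ρ.IsModular

/-- The purely Galois-theoretic statement: every surjective `ρ̄ : Γ_ℚ → GL₂(𝔽₃)` with cyclotomic
determinant is modular (Tunnell 1981, octahedral case, in the tree's `IsModular` currency). -/
abbrev SigOctahedralCycDet : Prop :=
  ∀ (ρ : ModPGaloisRep ℚ (ZMod 3) 2), Function.Surjective ρ →
    (∀ σ, Matrix.GeneralLinearGroup.det (ρ σ) = modPCyclotomicCharacterZMod ℚ 3 σ) → ρ.IsModular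

/-- Rubin 1997, Thm. 3 at `p = 3`, `F = ℚ` (would be a Literature named fact; NOT in the tree):
every `ρ̄ : Γ_ℚ → GL₂(𝔽₃)` with `det ρ̄ = χ̄₃` is (a framing of) `E[3]` for some elliptic `E/ℚ`. -/
def Rubin1997_theorem3_modThree : Prop :=
  ∀ (ρ : ModPGaloisRep ℚ (ZMod 3) 2),
    (∀ σ, Matrix.GeneralLinearGroup.det (ρ σ) = modPCyclotomicCharacterZMod ℚ 3 σ) →
      ∃ (W : WeierstrassCurve ℚ), ∃ _ : W.IsElliptic, W.IsTorsionGaloisRep 3 ρ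

/-- L-C1 (trivial direction, tree only: Weil pairing `det ρ̄_{E,3} = χ̄₃`). -/
theorem sigStubModThreeSurj_of_octahedral (h : SigOctahedralCycDet) : SigStubModThreeSurj := by
  intro W _ ρ hρ hsurj
  haveI : Fact (Nat.Prime 3) := ⟨by norm_num⟩
  exact h ρ hsurj
    (fun σ => W.det_eq_modPCyclotomicCharacter_of_isTorsionGaloisRep_holds 3 ρ hρ σ)

/-- L-C2 (Rubin Thm 3 ⇒ the `∀ W` form is the full octahedral case). -/
theorem octahedral_of_sigStubModThreeSurj (hR : Rubin1997_theorem3_modThree)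
    (h : SigStubModThreeSurj) : SigOctahedralCycDet := by
  intro ρ hsurj hdet
  obtain ⟨W, hW, hρ⟩ := hR ρ hdet
  exact h W ρ hρ hsurj

/-- L-C3: modulo Rubin's theorem the two statements coincide. -/
theorem sigStubModThreeSurj_iff_octahedral (hR : Rubin1997_theorem3_modThree) :
    SigStubModThreeSurj ↔ SigOctahedralCycDet :=
  ⟨octahedral_of_sigStubModThreeSurj hR, sigStubModThreeSurj_of_octahedral⟩

end Summit.ABC.ABC.Cruxes.FreyModularity.StubIdeasModThree3G15
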